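import Summits.NavierStokesRegularity.NavierStokesRegularity.Theorems.EulerZoomLiouvillePowerGaugeEulerLiouvilleNeedleSphereSlices

/-!
# Needle thinness, sphere by sphere (plate S3 of ROUND-36 «the needle's price, sphere by sphere»)

The length–area kernel `NeedleLogCapacity.core_radius_le_of_area` (t36) run on ONE sphere `S_t` through the
orthographic chart (S1), at a radius chosen by Chebyshev inside a prescribed set `T` of radii (S2):

* `sphereSlice_radius_le` — per-sphere slice lemma: a `κ`-core `−⟪y, V y⟫ ≥ M` on the chart disc `D̄_w(z₀)`,
  super-level area `≤ π(δ²−w²)/2` and chart energy `< S` force `w ≤ δ·exp(−π(M−m)²(t²−r²)/(2t²S))`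
  (`r` = radius of the chart disc used, distortion `t²/(t²−r²)`);
* `exists_thin_sphere` — for ball data `∫_{B_{2L}}‖∇V‖² ≤ 𝓔`, `∫_{B_{2L}}|V|² ≤ 𝓐` and any measurable `T ⊆ (L,2L)`
  with `|T| ≥ L/6` there is `t ∈ T` such that EVERY `κt²`-core of the flux observable inside the `0.9t` chart disc
  has radius `w ≤ δ·exp(−19πκ²t⁴L/(12800(𝓐 + 4L²𝓔)))` once `64𝓐/(κ²L³) ≤ π(δ²−w²)/2`.

Whole-sphere budgets make the estimate independent of WHERE on the sphere the core sits (cone Tonelli, S2), which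
is what a needle that bends with the radius requires. No Euler content. [length–area method; Tonelli; Chebyshev]
-/

set_option linter.dupNamespace false

open MeasureTheory Set Metric Real
open scoped RealInnerProductSpace ENNReal

namespace Summit.NavierStokesRegularity.NavierStokesRegularity.Theorems.PowerGaugeEulerLiouville.NeedleSphereThinness

open NeedleLogCapacity NeedleDiscChart NeedleSphereChart NeedleThinness

/-! ## 1. Translation bookkeeping on discs -/

/-- Translating a disc: `∫_{D_δ(0)} G(z₀ + ζ) dζ ≤ ∫_S G` when `D_δ(z₀) ⊆ S`. [folklore: translation invariance] -/
theorem lintegral_ball_shift_le (G : ℂ → ℝ≥0∞) (z₀ : ℂ) {δ : ℝ} {S : Set ℂ} (hS : ball z₀ δ ⊆ S) :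
    ∫⁻ ζ in ball (0 : ℂ) δ, G (z₀ + ζ) ≤ ∫⁻ z in S, G z := by
  have hiff : ∀ ζ : ℂ, z₀ + ζ ∈ ball z₀ δ ↔ ζ ∈ ball (0 : ℂ) δ := by
    intro ζ
    rw [mem_ball, mem_ball_zero_iff, dist_eq_norm, add_sub_cancel_left]
  have h1 : ∫⁻ ζ in ball (0 : ℂ) δ, G (z₀ + ζ) = ∫⁻ ζ, (ball z₀ δ).indicator G (z₀ + ζ) := by
    rw [← lintegral_indicator measurableSet_ball]
    refine lintegral_congr fun ζ => ?_
    by_cases h : ζ ∈ ball (0 : ℂ) δ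
    · rw [indicator_of_mem h, indicator_of_mem ((hiff ζ).2 h)]
    · rw [indicator_of_notMem h, indicator_of_notMem (mt (hiff ζ).1 h)]
  rw [h1, lintegral_add_left_eq_self ((ball z₀ δ).indicator G) z₀, lintegral_indicator measurableSet_ball]
  exact lintegral_mono_set hS

/-- Translating a super-level set: `|{‖ζ‖ < δ, P(z₀+ζ)}| ≤ |{z ∈ S, P z}|` when `D_δ(z₀) ⊆ S`. [folklore] -/
theorem volume_shift_le {P : ℂ → Prop} (z₀ : ℂ) {δ : ℝ} {S : Set ℂ} (hS : ball z₀ δ ⊆ S) :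
    volume {ζ : ℂ | ‖ζ‖ < δ ∧ P (z₀ + ζ)} ≤ volume {z : ℂ | z ∈ S ∧ P z} := by
  have h1 : {ζ : ℂ | ‖ζ‖ < δ ∧ P (z₀ + ζ)} = (fun ζ => z₀ + ζ) ⁻¹' {z | z ∈ ball z₀ δ ∧ P z} := by
    ext ζ
    simp only [mem_setOf_eq, mem_preimage, mem_ball, dist_eq_norm, add_sub_cancel_left]
  rw [h1, measure_preimage_add]
  exact measure_mono fun z hz => ⟨hS hz.1, hz.2⟩

/-- Real form of a strict extended bound for a continuous non-negative integrand on a disc. [folklore] -/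
theorem integral_lt_of_lintegral_lt {B : ℂ → ℝ} (hB : Continuous B) (hB0 : ∀ z, 0 ≤ B z) {δ X : ℝ} (hX : 0 < X)
    (hlt : ∫⁻ z in ball (0 : ℂ) δ, ENNReal.ofReal (B z) < ENNReal.ofReal X) :
    ∫ z in ball (0 : ℂ) δ, B z < X := by
  have hint : IntegrableOn B (ball (0 : ℂ) δ) :=
    (hB.continuousOn.integrableOn_compact (isCompact_closedBall (0 : ℂ) δ)).mono_set ball_subset_closedBall
  rw [← ofReal_integral_eq_lintegral_ofReal hint (Filter.Eventually.of_forall hB0),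
    ENNReal.ofReal_lt_ofReal_iff hX] at hlt
  exact hlt

/-! ## 2. The slice lemma on one sphere -/

section Slice

variable {V : (EuclideanSpace ℝ (Fin 3)) → (EuclideanSpace ℝ (Fin 3))}
  {V' : (EuclideanSpace ℝ (Fin 3)) → (EuclideanSpace ℝ (Fin 3)) →L[ℝ] (EuclideanSpace ℝ (Fin 3))}
  {e e₁ e₂ : (EuclideanSpace ℝ (Fin 3))}

/-- **Slice lemma on a sphere.**  `V ∈ C¹`; chart `Φ = sphereChart e e₁ e₂ t` of the sphere `S_t`, a chart disc
`D̄_δ(z₀)` inside `‖z‖ ≤ r < t`; the flux observable `f(ζ) = −⟪Φ(z₀+ζ), V(Φ(z₀+ζ))⟫` satisfies `f ≥ M` on `‖ζ‖ ≤ w`,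
`|{‖ζ‖ < δ, f > m}| ≤ π(δ²−w²)/2`, `m < M`, and the chart energy `∫_{D_δ}(|V|² + t²‖∇V‖²)∘Φ < S`:
then `w ≤ δ·exp(−π(M−m)²(t²−r²)/(2t²S))`. [length–area method: t36 `core_radius_le_of_area` + S1 chart calculus] -/
theorem sphereSlice_radius_le (hV : ∀ y, HasFDerivAt V (V' y) y) (hV'c : Continuous V')
    (hon : Orthonormal ℝ ![e, e₁, e₂]) {t r δ w m M S : ℝ} {z₀ : ℂ} (hr : r < t) (hz₀ : ‖z₀‖ + δ ≤ r)
    (hw : 0 < w) (hwδ : w < δ) (hmM : m < M) (hS : 0 < S)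
    (hM : ∀ ζ : ℂ, ‖ζ‖ ≤ w →
      M ≤ -⟪sphereChart e e₁ e₂ t (z₀ + ζ), V (sphereChart e e₁ e₂ t (z₀ + ζ))⟫)
    (harea : volume {ζ : ℂ | ‖ζ‖ < δ ∧
        m < -⟪sphereChart e e₁ e₂ t (z₀ + ζ), V (sphereChart e e₁ e₂ t (z₀ + ζ))⟫} ≤
      ENNReal.ofReal (π * (δ ^ 2 - w ^ 2) / 2))
    (hSE : ∫⁻ ζ in ball (0 : ℂ) δ, (‖V (sphereChart e e₁ e₂ t (z₀ + ζ))‖ₑ ^ 2 +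
        ENNReal.ofReal (‖sphereChart e e₁ e₂ t (z₀ + ζ)‖ ^ 2) * ‖V' (sphereChart e e₁ e₂ t (z₀ + ζ))‖ₑ ^ 2) <
      ENNReal.ofReal S) :
    w ≤ δ * Real.exp (-(π * (M - m) ^ 2 * (t ^ 2 - r ^ 2) / (2 * t ^ 2 * S))) := by
  have he := norm_frame₀ hon; have h₁ := norm_frame₁ hon; have h₂ := norm_frame₂ hon
  have he1 := inner_frame₀₁ hon; have he2 := inner_frame₀₂ hon; have h12 := inner_frame₁₂ hon
  have hVc : Continuous V := continuous_iff_continuousAt.2 fun y => (hV y).continuousAt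
  have hΦc := continuous_sphereChart e e₁ e₂ t
  have hsh : Continuous fun ζ : ℂ => z₀ + ζ := continuous_const.add continuous_id
  have hδ : 0 < δ := hw.trans hwδ
  have hz₀r : ‖z₀‖ < r := by linarith [norm_nonneg z₀]
  have ht : 0 < t := (lt_of_le_of_lt (norm_nonneg z₀) hz₀r).trans hr
  have htr : 0 < t ^ 2 - r ^ 2 := by nlinarith [norm_nonneg z₀]
  have hin : ∀ ζ ∈ closedBall (0 : ℂ) δ, ‖z₀ + ζ‖ ≤ r := fun ζ hζ =>
    (norm_add_le _ _).trans (by rw [mem_closedBall_zero_iff] at hζ; linarith)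
  have hint : ∀ ζ ∈ closedBall (0 : ℂ) δ, ‖z₀ + ζ‖ < t := fun ζ hζ => (hin ζ hζ).trans_lt hr
  -- differentiability of the translated flux observable on the closed disc
  have hfd : ∀ ζ ∈ closedBall (0 : ℂ) δ,
      HasFDerivAt (fun ζ : ℂ => -⟪sphereChart e e₁ e₂ t (z₀ + ζ), V (sphereChart e e₁ e₂ t (z₀ + ζ))⟫)
        (-(sphereFluxDeriv e e₁ e₂ t (z₀ + ζ) (V (sphereChart e e₁ e₂ t (z₀ + ζ)))
          (V' (sphereChart e e₁ e₂ t (z₀ + ζ))))) ζ := by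
    intro ζ hζ
    have h0 : HasFDerivAt (fun ζ : ℂ => z₀ + ζ) (ContinuousLinearMap.id ℝ ℂ) ζ := (hasFDerivAt_id ζ).const_add z₀
    have h1 := hasFDerivAt_sphereFlux e e₁ e₂ (hint ζ hζ) (hV (sphereChart e e₁ e₂ t (z₀ + ζ)))
    simpa only [Function.comp_def, ContinuousLinearMap.comp_id, Pi.neg_def] using (h1.comp ζ h0).neg
  have hf'c : ContinuousOn (fun ζ : ℂ => -(sphereFluxDeriv e e₁ e₂ t (z₀ + ζ)
      (V (sphereChart e e₁ e₂ t (z₀ + ζ))) (V' (sphereChart e e₁ e₂ t (z₀ + ζ))))) (closedBall (0 : ℂ) δ) := by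
    have hc := continuousOn_sphereFluxDeriv hVc hV'c e e₁ e₂ t
    have hmaps : MapsTo (fun ζ : ℂ => z₀ + ζ) (closedBall (0 : ℂ) δ) (ball (0 : ℂ) t) :=
      fun ζ hζ => mem_ball_zero_iff.2 (hint ζ hζ)
    exact (hc.comp hsh.continuousOn hmaps).neg
  -- pointwise bound of the derivative by a continuous majorant
  have hfB : ∀ ζ ∈ ball (0 : ℂ) δ,
      ‖-(sphereFluxDeriv e e₁ e₂ t (z₀ + ζ) (V (sphereChart e e₁ e₂ t (z₀ + ζ)))
          (V' (sphereChart e e₁ e₂ t (z₀ + ζ))))‖ ^ 2 ≤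
        t ^ 2 / (t ^ 2 - r ^ 2) * (2 * ‖V (sphereChart e e₁ e₂ t (z₀ + ζ))‖ ^ 2 +
          2 * (t * ‖V' (sphereChart e e₁ e₂ t (z₀ + ζ))‖) ^ 2) := by
    intro ζ hζ
    have hζ' : ζ ∈ closedBall (0 : ℂ) δ := ball_subset_closedBall hζ
    have hzt := hint ζ hζ'
    have hzr := hin ζ hζ'
    rw [norm_neg]
    have h1 := norm_sphereFluxDeriv_sq_le he h₁ h₂ he1 he2 h12 hzt (V (sphereChart e e₁ e₂ t (z₀ + ζ)))
      (V' (sphereChart e e₁ e₂ t (z₀ + ζ)))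
    have hsq : 0 < Real.sqrt (t ^ 2 - r ^ 2) := Real.sqrt_pos.2 htr
    have hc2 : t ^ 2 - r ^ 2 ≤ capHeight t (z₀ + ζ) ^ 2 := by
      calc t ^ 2 - r ^ 2 = Real.sqrt (t ^ 2 - r ^ 2) ^ 2 := (Real.sq_sqrt htr.le).symm
        _ ≤ capHeight t (z₀ + ζ) ^ 2 := pow_le_pow_left₀ hsq.le (sqrt_le_capHeight hzr) 2
    have h2 : (t / capHeight t (z₀ + ζ)) ^ 2 ≤ t ^ 2 / (t ^ 2 - r ^ 2) := by
      rw [div_pow]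
      exact div_le_div_of_nonneg_left (sq_nonneg t) htr hc2
    exact h1.trans (mul_le_mul_of_nonneg_right h2 (by positivity))
  -- the energy of the observable on the disc
  have hE : ∫ ζ in ball (0 : ℂ) δ, ‖-(sphereFluxDeriv e e₁ e₂ t (z₀ + ζ)
      (V (sphereChart e e₁ e₂ t (z₀ + ζ))) (V' (sphereChart e e₁ e₂ t (z₀ + ζ))))‖ ^ 2 ≤
        2 * t ^ 2 * S / (t ^ 2 - r ^ 2) := by
    have hBc : Continuous fun ζ : ℂ => t ^ 2 / (t ^ 2 - r ^ 2) *
        (2 * ‖V (sphereChart e e₁ e₂ t (z₀ + ζ))‖ ^ 2 + 2 * (t * ‖V' (sphereChart e e₁ e₂ t (z₀ + ζ))‖) ^ 2) :=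
      continuous_const.mul ((continuous_const.mul ((hVc.comp (hΦc.comp hsh)).norm.pow 2)).add
        (continuous_const.mul ((continuous_const.mul (hV'c.comp (hΦc.comp hsh)).norm).pow 2)))
    have hB0 : ∀ ζ : ℂ, 0 ≤ t ^ 2 / (t ^ 2 - r ^ 2) *
        (2 * ‖V (sphereChart e e₁ e₂ t (z₀ + ζ))‖ ^ 2 + 2 * (t * ‖V' (sphereChart e e₁ e₂ t (z₀ + ζ))‖) ^ 2) :=
      fun ζ => by positivity
    have hintB := (hBc.continuousOn.integrableOn_compact (μ := volume) (isCompact_closedBall (0 : ℂ) δ)).mono_set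
      (ball_subset_closedBall (x := (0 : ℂ)) (ε := δ))
    have hle := integral_mono_of_nonneg (μ := volume.restrict (ball (0 : ℂ) δ))
      (Filter.Eventually.of_forall fun ζ => sq_nonneg _) hintB
      ((ae_restrict_iff' measurableSet_ball).2 (Filter.Eventually.of_forall hfB))
    refine hle.trans (le_of_lt (integral_lt_of_lintegral_lt hBc hB0 (by positivity) ?_))
    -- the extended integral of the majorant is (2t²/(t²−r²)) · chart energy
    have hpt : ∀ ζ ∈ ball (0 : ℂ) δ, ENNReal.ofReal (t ^ 2 / (t ^ 2 - r ^ 2) *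
        (2 * ‖V (sphereChart e e₁ e₂ t (z₀ + ζ))‖ ^ 2 + 2 * (t * ‖V' (sphereChart e e₁ e₂ t (z₀ + ζ))‖) ^ 2)) =
        ENNReal.ofReal (2 * t ^ 2 / (t ^ 2 - r ^ 2)) * (‖V (sphereChart e e₁ e₂ t (z₀ + ζ))‖ₑ ^ 2 +
          ENNReal.ofReal (‖sphereChart e e₁ e₂ t (z₀ + ζ)‖ ^ 2) * ‖V' (sphereChart e e₁ e₂ t (z₀ + ζ))‖ₑ ^ 2) := by
      intro ζ hζ
      have hn : ‖sphereChart e e₁ e₂ t (z₀ + ζ)‖ = t :=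
        norm_sphereChart he h₁ h₂ he1 he2 h12 ht.le (hint ζ (ball_subset_closedBall hζ)).le
      have hv : ‖V (sphereChart e e₁ e₂ t (z₀ + ζ))‖ₑ ^ 2 =
          ENNReal.ofReal (‖V (sphereChart e e₁ e₂ t (z₀ + ζ))‖ ^ 2) := by
        rw [← ofReal_norm, ENNReal.ofReal_pow (norm_nonneg _)]
      have hv' : ‖V' (sphereChart e e₁ e₂ t (z₀ + ζ))‖ₑ ^ 2 =
          ENNReal.ofReal (‖V' (sphereChart e e₁ e₂ t (z₀ + ζ))‖ ^ 2) := by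
        rw [← ofReal_norm, ENNReal.ofReal_pow (norm_nonneg _)]
      rw [hn, hv, hv', ← ENNReal.ofReal_mul (sq_nonneg t), ← ENNReal.ofReal_add (sq_nonneg _) (by positivity),
        ← ENNReal.ofReal_mul (by positivity)]
      congr 1
      ring
    rw [setLIntegral_congr_fun measurableSet_ball hpt, lintegral_const_mul' _ _ ENNReal.ofReal_ne_top]
    have hc0 : ENNReal.ofReal (2 * t ^ 2 / (t ^ 2 - r ^ 2)) ≠ 0 := (ENNReal.ofReal_pos.2 (by positivity)).ne'
    calc ENNReal.ofReal (2 * t ^ 2 / (t ^ 2 - r ^ 2)) * ∫⁻ ζ in ball (0 : ℂ) δ,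
          (‖V (sphereChart e e₁ e₂ t (z₀ + ζ))‖ₑ ^ 2 + ENNReal.ofReal (‖sphereChart e e₁ e₂ t (z₀ + ζ)‖ ^ 2) *
            ‖V' (sphereChart e e₁ e₂ t (z₀ + ζ))‖ₑ ^ 2)
        < ENNReal.ofReal (2 * t ^ 2 / (t ^ 2 - r ^ 2)) * ENNReal.ofReal S :=
          ENNReal.mul_lt_mul_right hc0 ENNReal.ofReal_ne_top hSE
      _ = ENNReal.ofReal (2 * t ^ 2 * S / (t ^ 2 - r ^ 2)) := by
          rw [← ENNReal.ofReal_mul (by positivity)]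
          congr 1
          field_simp
  have hcore := core_radius_le_of_area
    (f := fun ζ : ℂ => -⟪sphereChart e e₁ e₂ t (z₀ + ζ), V (sphereChart e e₁ e₂ t (z₀ + ζ))⟫)
    (f' := fun ζ : ℂ => -(sphereFluxDeriv e e₁ e₂ t (z₀ + ζ) (V (sphereChart e e₁ e₂ t (z₀ + ζ)))
      (V' (sphereChart e e₁ e₂ t (z₀ + ζ)))))
    hw hwδ hfd hf'c (fun ζ hζ => hM ζ (mem_closedBall_zero_iff.1 hζ)) hmM harea hE
  have heq : π * (M - m) ^ 2 / (2 * t ^ 2 * S / (t ^ 2 - r ^ 2)) =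
      π * (M - m) ^ 2 * (t ^ 2 - r ^ 2) / (2 * t ^ 2 * S) := by
    field_simp
  rwa [heq] at hcore

end Slice

/-! ## 3. Measurability of cone-slice functionals -/

/-- For measurable `g ≥ 0` the cone-slice functional `t ↦ ∫_{‖z‖ < θt} g (sphereChart e e₁ e₂ t z) dz` is measurable.
[folklore: measurability of parametrised integrals] -/
theorem measurable_coneSlice {g : (EuclideanSpace ℝ (Fin 3)) → ℝ≥0∞} (hg : Measurable g)
    (e e₁ e₂ : (EuclideanSpace ℝ (Fin 3))) (θ : ℝ) :
    Measurable fun t : ℝ => ∫⁻ z in ball (0 : ℂ) (θ * t), g (sphereChart e e₁ e₂ t z) := by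
  set K : Set (ℝ × ℂ) := {p | ‖p.2‖ < θ * p.1} with hK
  have hKm : MeasurableSet K := measurableSet_lt continuous_snd.norm.measurable (measurable_fst.const_mul θ)
  set H : ℝ × ℂ → ℝ≥0∞ := K.indicator fun p => g (sphereChart e e₁ e₂ p.1 p.2) with hH
  have hHm : Measurable H := (hg.comp (continuous_sphereChart₂ e e₁ e₂).measurable).indicator hKm
  have heq : (fun t : ℝ => ∫⁻ z in ball (0 : ℂ) (θ * t), g (sphereChart e e₁ e₂ t z)) =
      fun t => ∫⁻ z, H (t, z) := by
    funext t
    rw [← lintegral_indicator measurableSet_ball]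
    refine lintegral_congr fun z => ?_
    by_cases h : ‖z‖ < θ * t
    · have hz : z ∈ ball (0 : ℂ) (θ * t) := mem_ball_zero_iff.2 h
      have hk : (t, z) ∈ K := h
      rw [indicator_of_mem hz, hH, indicator_of_mem hk]
    · have hz : z ∉ ball (0 : ℂ) (θ * t) := fun hz => h (mem_ball_zero_iff.1 hz)
      have hk : (t, z) ∉ K := h
      rw [indicator_of_notMem hz, hH, indicator_of_notMem hk]
  rw [heq]
  exact hHm.lintegral_prod_right'

/-! ## 4. A thin sphere in every large set of radii -/

section Assembly

variable {V : (EuclideanSpace ℝ (Fin 3)) → (EuclideanSpace ℝ (Fin 3))}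
  {V' : (EuclideanSpace ℝ (Fin 3)) → (EuclideanSpace ℝ (Fin 3)) →L[ℝ] (EuclideanSpace ℝ (Fin 3))}
  {e e₁ e₂ : (EuclideanSpace ℝ (Fin 3))}

/-- **Thin sphere.**  `V ∈ C¹(ℝ³)` with `∫_{B_{2L}}‖∇V‖² ≤ 𝓔`, `∫_{B_{2L}}|V|² ≤ 𝓐`; `(e,e₁,e₂)` orthonormal; `T ⊆ (L,2L)`
measurable with `|T| ≥ L/6`. Then some `t ∈ T` is THIN: for every chart centre `z₀` and radii `0 < w < δ` with
`‖z₀‖ + δ ≤ 0.9t` and the area budget `64𝓐/(κ²L³) ≤ π(δ²−w²)/2`, a core `−⟪y, V y⟫ ≥ κt²` on the chart disc `D̄_w(z₀)`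
of the sphere `S_t` has `w ≤ δ·exp(−19πκ²t⁴L/(12800(𝓐 + 4L²𝓔)))`.  (Two cone-Tonelli budgets — chart energy
`∫_t ∫ (|V|²+t²‖∇V‖²)∘Φ_t ≤ 𝓐 + 4L²𝓔` and Chebyshev area `∫_t |{‖V∘Φ_t‖ > κt/2}| ≤ 4𝓐/(κ²L²)` — a good radius in `T`,
then the slice lemma with `M = κt²`, `m = κt²/2`, `r = 0.9t`.) [length–area method; Tonelli; Chebyshev] -/
theorem exists_thin_sphere (hV : ∀ y, HasFDerivAt V (V' y) y) (hV'c : Continuous V')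
    (hon : Orthonormal ℝ ![e, e₁, e₂]) {L κ 𝓔 𝓐 : ℝ} (hL : 0 < L) (hκ : 0 < κ) (h𝓔 : 0 < 𝓔) (h𝓐 : 0 < 𝓐)
    (hE : ∫⁻ y in ball (0 : EuclideanSpace ℝ (Fin 3)) (2 * L), ‖V' y‖ₑ ^ 2 ≤ ENNReal.ofReal 𝓔)
    (hA : ∫⁻ y in ball (0 : EuclideanSpace ℝ (Fin 3)) (2 * L), ‖V y‖ₑ ^ 2 ≤ ENNReal.ofReal 𝓐)
    {T : Set ℝ} (hT : MeasurableSet T) (hTI : T ⊆ Ioo L (2 * L)) (hTvol : ENNReal.ofReal (L / 6) ≤ volume T) :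
    ∃ t ∈ T, ∀ (z₀ : ℂ) (δ w : ℝ), ‖z₀‖ + δ ≤ 9 / 10 * t → 0 < w → w < δ →
      64 * 𝓐 / (κ ^ 2 * L ^ 3) ≤ π * (δ ^ 2 - w ^ 2) / 2 →
      (∀ ζ : ℂ, ‖ζ‖ ≤ w →
        κ * t ^ 2 ≤ -⟪sphereChart e e₁ e₂ t (z₀ + ζ), V (sphereChart e e₁ e₂ t (z₀ + ζ))⟫) →
      w ≤ δ * Real.exp (-(19 * π * κ ^ 2 * t ^ 4 * L / (12800 * (𝓐 + 4 * L ^ 2 * 𝓔)))) := by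
  have he := norm_frame₀ hon; have h₁ := norm_frame₁ hon; have h₂ := norm_frame₂ hon
  have he1 := inner_frame₀₁ hon; have he2 := inner_frame₀₂ hon; have h12 := inner_frame₁₂ hon
  have hVc : Continuous V := continuous_iff_continuousAt.2 fun y => (hV y).continuousAt
  -- the shell receiving the chart points
  set Sh : Set (EuclideanSpace ℝ (Fin 3)) := {y | L < ‖y‖ ∧ ‖y‖ < 2 * L} with hSh
  have hShm : MeasurableSet Sh :=
    ((isOpen_lt continuous_const continuous_norm).inter (isOpen_lt continuous_norm continuous_const)).measurableSet
  have hShball : Sh ⊆ ball (0 : EuclideanSpace ℝ (Fin 3)) (2 * L) := fun y hy => mem_ball_zero_iff.2 hy.2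
  have hIpos : ∀ t ∈ Ioo L (2 * L), 0 < t := fun t ht => hL.trans ht.1
  have hθ1 : (9 / 10 : ℝ) ≤ 1 := by norm_num
  have hnormΦ : ∀ t ∈ Ioo L (2 * L), ∀ z : ℂ, ‖z‖ < 9 / 10 * t → ‖sphereChart e e₁ e₂ t z‖ = t :=
    fun t ht z hz => norm_sphereChart he h₁ h₂ he1 he2 h12 (hIpos t ht).le (by nlinarith [hIpos t ht])
  have hmaps : ∀ t ∈ Ioo L (2 * L), ∀ z : ℂ, ‖z‖ < 9 / 10 * t → sphereChart e e₁ e₂ t z ∈ Sh := by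
    intro t ht z hz
    rw [hSh, mem_setOf_eq, hnormΦ t ht z hz]
    exact ht
  -- the two integrands on ℝ³
  set gE : (EuclideanSpace ℝ (Fin 3)) → ℝ≥0∞ := fun y => ‖V y‖ₑ ^ 2 + ENNReal.ofReal (‖y‖ ^ 2) * ‖V' y‖ₑ ^ 2
    with hgE
  have hgEm : Measurable gE := (hVc.measurable.enorm.pow_const 2).add
    ((continuous_norm.pow 2).measurable.ennreal_ofReal.mul (hV'c.measurable.enorm.pow_const 2))
  set U : Set (EuclideanSpace ℝ (Fin 3)) := {y | κ * ‖y‖ / 2 < ‖V y‖} with hU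
  have hUm : MeasurableSet U :=
    measurableSet_lt ((continuous_const.mul continuous_norm).div_const 2).measurable hVc.norm.measurable
  set gA : (EuclideanSpace ℝ (Fin 3)) → ℝ≥0∞ := U.indicator 1 with hgA
  have hgAm : Measurable gA := measurable_one.indicator hUm
  -- the slice functionals and their budgets
  have hF₁m := measurable_coneSlice hgEm e e₁ e₂ (9 / 10)
  have hF₂m := measurable_coneSlice hgAm e e₁ e₂ (9 / 10)
  have hX : 0 < 𝓐 + 4 * L ^ 2 * 𝓔 := by positivity
  have hY : 0 < 4 * 𝓐 / (κ ^ 2 * L ^ 2) := by positivity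
  have hI₁ : ∫⁻ t in Ioo L (2 * L), ∫⁻ z in ball (0 : ℂ) (9 / 10 * t), gE (sphereChart e e₁ e₂ t z) ≤
      ENNReal.ofReal (𝓐 + 4 * L ^ 2 * 𝓔) := by
    refine (lintegral_cone_le hon hgEm measurableSet_Ioo hIpos hθ1 hShm hmaps).trans ?_
    have h1 : ∫⁻ y in Sh, ‖V y‖ₑ ^ 2 ≤ ENNReal.ofReal 𝓐 := (lintegral_mono_set hShball).trans hA
    have h2 : ∫⁻ y in Sh, ENNReal.ofReal (‖y‖ ^ 2) * ‖V' y‖ₑ ^ 2 ≤ ENNReal.ofReal (4 * L ^ 2) * ENNReal.ofReal 𝓔 := by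
      calc ∫⁻ y in Sh, ENNReal.ofReal (‖y‖ ^ 2) * ‖V' y‖ₑ ^ 2
          ≤ ∫⁻ y in Sh, ENNReal.ofReal (4 * L ^ 2) * ‖V' y‖ₑ ^ 2 := by
            refine setLIntegral_mono' hShm fun y hy => ?_
            refine mul_le_mul_of_nonneg_right (ENNReal.ofReal_le_ofReal ?_) bot_le
            nlinarith [hy.2, norm_nonneg y]
        _ = ENNReal.ofReal (4 * L ^ 2) * ∫⁻ y in Sh, ‖V' y‖ₑ ^ 2 := lintegral_const_mul' _ _ ENNReal.ofReal_ne_top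
        _ ≤ ENNReal.ofReal (4 * L ^ 2) * ENNReal.ofReal 𝓔 :=
            mul_le_mul_of_nonneg_left ((lintegral_mono_set hShball).trans hE) bot_le
    calc ∫⁻ y in Sh, gE y = (∫⁻ y in Sh, ‖V y‖ₑ ^ 2) + ∫⁻ y in Sh, ENNReal.ofReal (‖y‖ ^ 2) * ‖V' y‖ₑ ^ 2 :=
          lintegral_add_left (hVc.measurable.enorm.pow_const 2) _
      _ ≤ ENNReal.ofReal 𝓐 + ENNReal.ofReal (4 * L ^ 2) * ENNReal.ofReal 𝓔 := add_le_add h1 h2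
      _ = ENNReal.ofReal (𝓐 + 4 * L ^ 2 * 𝓔) := by
          rw [← ENNReal.ofReal_mul (by positivity), ← ENNReal.ofReal_add h𝓐.le (by positivity)]
  have hI₂ : ∫⁻ t in Ioo L (2 * L), ∫⁻ z in ball (0 : ℂ) (9 / 10 * t), gA (sphereChart e e₁ e₂ t z) ≤
      ENNReal.ofReal (4 * 𝓐 / (κ ^ 2 * L ^ 2)) := by
    refine (lintegral_cone_le hon hgAm measurableSet_Ioo hIpos hθ1 hShm hmaps).trans ?_
    have hvol : ∫⁻ y in Sh, gA y = volume (U ∩ Sh) := by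
      rw [hgA, lintegral_indicator_one hUm, Measure.restrict_apply hUm]
    rw [hvol]
    have hUSm : MeasurableSet (U ∩ Sh) := hUm.inter hShm
    have hlow : ∀ y ∈ U ∩ Sh, ENNReal.ofReal ((κ * L / 2) ^ 2) ≤ ‖V y‖ₑ ^ 2 := by
      intro y hy
      have hyU : κ * ‖y‖ / 2 < ‖V y‖ := hy.1
      have hyL : L < ‖y‖ := hy.2.1
      have h1 : κ * L / 2 ≤ ‖V y‖ := by nlinarith
      rw [← ofReal_norm, ← ENNReal.ofReal_pow (norm_nonneg _)]
      exact ENNReal.ofReal_le_ofReal (pow_le_pow_left₀ (by positivity) h1 2)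
    have hch : ENNReal.ofReal ((κ * L / 2) ^ 2) * volume (U ∩ Sh) ≤ ENNReal.ofReal 𝓐 := by
      calc ENNReal.ofReal ((κ * L / 2) ^ 2) * volume (U ∩ Sh)
          = ∫⁻ _ in U ∩ Sh, ENNReal.ofReal ((κ * L / 2) ^ 2) := (setLIntegral_const _ _).symm
        _ ≤ ∫⁻ y in U ∩ Sh, ‖V y‖ₑ ^ 2 := setLIntegral_mono' hUSm hlow
        _ ≤ ∫⁻ y in ball (0 : EuclideanSpace ℝ (Fin 3)) (2 * L), ‖V y‖ₑ ^ 2 :=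
            lintegral_mono_set (inter_subset_right.trans hShball)
        _ ≤ ENNReal.ofReal 𝓐 := hA
    have hk : ENNReal.ofReal ((κ * L / 2) ^ 2) ≠ 0 := (ENNReal.ofReal_pos.2 (by positivity)).ne'
    calc volume (U ∩ Sh) ≤ ENNReal.ofReal 𝓐 / ENNReal.ofReal ((κ * L / 2) ^ 2) := by
          rw [ENNReal.le_div_iff_mul_le (Or.inl hk) (Or.inl ENNReal.ofReal_ne_top), mul_comm]; exact hch
      _ = ENNReal.ofReal (𝓐 / (κ * L / 2) ^ 2) := (ENNReal.ofReal_div_of_pos (by positivity)).symm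
      _ = ENNReal.ofReal (4 * 𝓐 / (κ ^ 2 * L ^ 2)) := by congr 1; field_simp; ring
  -- a good radius in T
  have hab : L < 2 * L := by linarith
  have hTvol' : ENNReal.ofReal ((2 * L - L) / 6) ≤ volume T := by rwa [show 2 * L - L = L by ring]
  obtain ⟨t, htT, hF₁t, hF₂t⟩ := exists_good_radius hF₁m hF₂m hab hX hY hI₁ hI₂ hT hTI hTvol'
  rw [show 2 * L - L = L by ring] at hF₁t hF₂t
  have htI := hTI htT
  have ht := hIpos t htI
  refine ⟨t, htT, fun z₀ δ w hz₀ hw hwδ hbudget hcore => ?_⟩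
  have hδ : 0 < δ := hw.trans hwδ
  have hsub : ball z₀ δ ⊆ ball (0 : ℂ) (9 / 10 * t) := by
    intro z hz
    rw [mem_ball, dist_eq_norm] at hz
    rw [mem_ball_zero_iff]
    calc ‖z‖ = ‖(z - z₀) + z₀‖ := by rw [sub_add_cancel]
      _ ≤ ‖z - z₀‖ + ‖z₀‖ := norm_add_le _ _
      _ < 9 / 10 * t := by linarith
  -- chart energy at the good radius, on the translated disc
  have hSE : ∫⁻ ζ in ball (0 : ℂ) δ, (‖V (sphereChart e e₁ e₂ t (z₀ + ζ))‖ₑ ^ 2 +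
      ENNReal.ofReal (‖sphereChart e e₁ e₂ t (z₀ + ζ)‖ ^ 2) * ‖V' (sphereChart e e₁ e₂ t (z₀ + ζ))‖ₑ ^ 2) <
      ENNReal.ofReal (16 * (𝓐 + 4 * L ^ 2 * 𝓔) / L) :=
    (lintegral_ball_shift_le (fun z => gE (sphereChart e e₁ e₂ t z)) z₀ hsub).trans_lt hF₁t
  -- super-level area at the good radius
  have harea : volume {ζ : ℂ | ‖ζ‖ < δ ∧
      κ * t ^ 2 / 2 < -⟪sphereChart e e₁ e₂ t (z₀ + ζ), V (sphereChart e e₁ e₂ t (z₀ + ζ))⟫} ≤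
      ENNReal.ofReal (π * (δ ^ 2 - w ^ 2) / 2) := by
    have h1 := volume_shift_le
      (P := fun z : ℂ => κ * t ^ 2 / 2 < -⟪sphereChart e e₁ e₂ t z, V (sphereChart e e₁ e₂ t z)⟫) z₀ hsub
    have hpre : MeasurableSet ((fun z : ℂ => sphereChart e e₁ e₂ t z) ⁻¹' U) :=
      hUm.preimage (continuous_sphereChart e e₁ e₂ t).measurable
    have h2 : {z : ℂ | z ∈ ball (0 : ℂ) (9 / 10 * t) ∧
        κ * t ^ 2 / 2 < -⟪sphereChart e e₁ e₂ t z, V (sphereChart e e₁ e₂ t z)⟫} ⊆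
        (fun z : ℂ => sphereChart e e₁ e₂ t z) ⁻¹' U ∩ ball (0 : ℂ) (9 / 10 * t) := by
      intro z hz
      refine ⟨?_, hz.1⟩
      have hn : ‖sphereChart e e₁ e₂ t z‖ = t := hnormΦ t htI z (mem_ball_zero_iff.1 hz.1)
      have hcs : -⟪sphereChart e e₁ e₂ t z, V (sphereChart e e₁ e₂ t z)⟫ ≤
          ‖sphereChart e e₁ e₂ t z‖ * ‖V (sphereChart e e₁ e₂ t z)‖ :=
        (neg_le_abs _).trans (abs_real_inner_le_norm _ _)
      rw [hn] at hcs
      have hz2 := hz.2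
      show κ * ‖sphereChart e e₁ e₂ t z‖ / 2 < ‖V (sphereChart e e₁ e₂ t z)‖
      rw [hn]
      nlinarith
    have h3 : volume ((fun z : ℂ => sphereChart e e₁ e₂ t z) ⁻¹' U ∩ ball (0 : ℂ) (9 / 10 * t)) =
        ∫⁻ z in ball (0 : ℂ) (9 / 10 * t), gA (sphereChart e e₁ e₂ t z) := by
      have hind : ∀ z : ℂ, gA (sphereChart e e₁ e₂ t z) =
          ((fun z : ℂ => sphereChart e e₁ e₂ t z) ⁻¹' U).indicator (1 : ℂ → ℝ≥0∞) z := by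
        intro z
        by_cases h : sphereChart e e₁ e₂ t z ∈ U
        · rw [hgA, indicator_of_mem h, indicator_of_mem (show z ∈ (fun z : ℂ => sphereChart e e₁ e₂ t z) ⁻¹' U
            from h)]
          rfl
        · rw [hgA, indicator_of_notMem h, indicator_of_notMem (show z ∉ (fun z : ℂ => sphereChart e e₁ e₂ t z) ⁻¹' U
            from h)]
      rw [lintegral_congr hind, lintegral_indicator_one hpre, Measure.restrict_apply hpre]
    calc volume {ζ : ℂ | ‖ζ‖ < δ ∧
          κ * t ^ 2 / 2 < -⟪sphereChart e e₁ e₂ t (z₀ + ζ), V (sphereChart e e₁ e₂ t (z₀ + ζ))⟫}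
        ≤ volume {z : ℂ | z ∈ ball (0 : ℂ) (9 / 10 * t) ∧
            κ * t ^ 2 / 2 < -⟪sphereChart e e₁ e₂ t z, V (sphereChart e e₁ e₂ t z)⟫} := h1
      _ ≤ volume ((fun z : ℂ => sphereChart e e₁ e₂ t z) ⁻¹' U ∩ ball (0 : ℂ) (9 / 10 * t)) := measure_mono h2
      _ = ∫⁻ z in ball (0 : ℂ) (9 / 10 * t), gA (sphereChart e e₁ e₂ t z) := h3
      _ ≤ ENNReal.ofReal (16 * (4 * 𝓐 / (κ ^ 2 * L ^ 2)) / L) := hF₂t.le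
      _ = ENNReal.ofReal (64 * 𝓐 / (κ ^ 2 * L ^ 3)) := by congr 1; field_simp; ring
      _ ≤ ENNReal.ofReal (π * (δ ^ 2 - w ^ 2) / 2) := ENNReal.ofReal_le_ofReal hbudget
  -- the slice lemma at the good radius
  have hmM : κ * t ^ 2 / 2 < κ * t ^ 2 := by linarith [show 0 < κ * t ^ 2 by positivity]
  have hr : 9 / 10 * t < t := by linarith
  have hS : 0 < 16 * (𝓐 + 4 * L ^ 2 * 𝓔) / L := by positivity
  have hk := sphereSlice_radius_le hV hV'c hon hr hz₀ hw hwδ hmM hS hcore harea hSE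
  have heq : π * (κ * t ^ 2 - κ * t ^ 2 / 2) ^ 2 * (t ^ 2 - (9 / 10 * t) ^ 2) /
      (2 * t ^ 2 * (16 * (𝓐 + 4 * L ^ 2 * 𝓔) / L)) = 19 * π * κ ^ 2 * t ^ 4 * L / (12800 * (𝓐 + 4 * L ^ 2 * 𝓔)) := by
    field_simp; ring
  rwa [heq] at hk

end Assembly

end Summit.NavierStokesRegularity.NavierStokesRegularity.Theorems.PowerGaugeEulerLiouville.NeedleSphereThinness
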